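import Summits.QuantumFields.BalabanUV.Beta.GAN24.ReadingWeightRates
import Summits.QuantumFields.BalabanUV.Beta.GAN24.AliasObjects
import Summits.QuantumFields.BalabanUV.Beta.GAN24.AliasTail

/-!
# `BalabanUV.Beta.GAN24.ReadingWeightRatesSum` — row G-an2-4 / (CONV-C), road P1, typer row **P1-Y11r** part 2 (N17r, LEAVES.md v2.2; Part B):
# reading-weight rates in the BINDING currency of `GAN24/AliasObjects` (T00), the RELATIVE form, product telescoping, and the alias TAIL (E3)

NOT IN PRINT; OUR PROOF ATTEMPT.  HONEST FRAMING (cell contract, verbatim): «discharging `BetaPertH` makes Bałaban's UV stability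
UNCONDITIONAL — a real constructive-QFT result; it is NOT the continuum limit and NOT the Clay problem.»  HONEST DEPENDENCY (verbatim):
«continuum YM on T⁴ ⇐ BetaPertH ∧ nine spine estimates (0/9 proved); BetaPertH ⇐ (D1) ∧ (D4) ∧ CAP+tail; G-an2-4 gates asym, D1 and
NE2/3/4.»  [folklore] explicit analysis; discharges NOTHING of (CONV-C) by itself: termwise ingredients which the bookkeeping row Y11d
(alias re-indexing `TorusSite D N ↪ TorusSite D (N·Lc)`, product telescoping over the legs, plug form) and p1's L11 `FibreRate` assemble into
the one-step rate (I2′), `θ = Lc⁻²`.  NOT `BetaPertH`, NOT continuum, NOT Clay.  One harmless real-valued `def` (`rdMaj`, the per-coordinate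
majorant); no `def … : Prop`, no cited fact, no wall binder; constants exact and symbolic in `(D, ρ = M/N = Lc⁻¹)`; NO unit re-typed (c2/c3).

## Typer scope note v2.2 (CLAIMS 23:51:05Z, binding): «remaining = (i) reading/source factor rates in `AliasObjects` currency, (iii) product
## assembly, (iv) tail via `AliasTail`» (item (ii) = leaf-10's `SymbolRate` p201257; part 1 `ReadingWeightRates` p201580 = label-currency rate)
* §1 BRIDGES at real momenta `p = ofRealVec pr`: `AliasObjects.gs` IS the explicit sum of leaf P1-L06 (`gs_eq`, `rfl`); `kAl N (ofRealVec pr) m κ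
  = ↑(kfine N pr m κ)`; `‖sMAl‖ = ‖gs(↑kfine) M‖`; `‖readW‖ = (Π_i ‖sMAl_i‖)·‖sMAl_κ‖/M^{D+1}` (unimodular phase) and `‖srcW‖ = ‖readW‖/N^D`
  (T00's `srcW_eq_conj`): the moduli of the T00 objects ARE products of the per-coordinate factors `‖gs(q_i/N, M)‖/M` of part 1 at the
  label `q_i = pr_i + 2π·repZ m i` (Lean representative; the symmetric one is Y11d's re-indexing).
* §2 (item (i), the form that SURVIVES THE ALIAS SUM) the majorant `rdMaj ρ q = min(1, π/(ρ|q|))` of the factor `r = ‖gs(q/N,M)‖/M` and of its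
  limit (`ρ = M/N`), the RELATIVE rate `|r − sincAt ρ q| ≤ (π/48)(q²/N²)·sincAt ρ q`, the two-level form `≤ (π/48)q²(N⁻²+N′⁻²)·rdMaj`, and for
  the SQUARED weights `|r_N² − r_{N′}²| ≤ (π/24)q²(N⁻²+N′⁻²)·rdMaj² ≤ (π³/24)ρ⁻²(N⁻²+N′⁻²)` UNIFORMLY in the label (`ρ⁻² = Lc²`).
* §3 (item (iii)) product telescoping with majorants `|Π a − Π b| ≤ Σ_i |a_i − b_i|·Π_{j≠i} c_j` and the `D`-fold squared reading weight rate
  `≤ (π³/24)ρ⁻²(N⁻²+N′⁻²)·Σ_i Π_{j≠i} rdMaj ρ q_j ²`; the summand rule `|WC − W′C′| ≤ …` is `SymbolRate.abs_mul_sub_mul_le` (not restated).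
* §4 (item (iv), TAIL) in offset currency `q_i = p_i + 2πn_i`: `rdMaj ρ q_i ² ≤ max(1, π/ρ²)·aliasMaj 2 p_i n_i`, hence by E3 `AliasTail` the far
  offsets (`∃ν, |n_ν| > R`) carry total squared reading weight `≤ max(1,π/ρ²)^D·D(2/π)(1+4/π)^{D−1}/R` (`sum_prod_rdMaj_sq_tail_le`).

Unit `b2b-balaban-gan24-formalise-leaf-17` (G-an2-4 formalisation swarm, leaf prover 17), 2026-08-19/20.  Value = kernel bookkeeping leaf
toward the K-slot route P1, NOT summit progress.
-/

noncomputable section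

open Complex Finset
open scoped BigOperators Real ComplexConjugate

namespace Summit.QuantumFields.BalabanUV.Beta.GAN24.ReadingWeightRatesSum

open Literature.Probability.LatticeModels (TorusSite)
open Literature.MathematicalPhysics.QuantumFieldTheory.LatticeForm (repZ)
open Literature.MathematicalPhysics.QuantumFieldTheory.Balaban1983to89.B4Strip (ofRealVec)
open Literature.MathematicalPhysics.QuantumFieldTheory.King1986 (aliasMaj aliasMaj_nonneg aliasBox)
open AliasWeights AliasWeightsClosedForm ReadingWeightRates AliasObjects

variable {D : ℕ}

/-! ## §1  Bridges: the T00 objects at real momenta are the explicit sums of leaf P1-L06 -/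
/-- [folklore] `AliasObjects.gs` IS the explicit geometric sum of `GAN24/AliasWeights`. -/
theorem gs_eq (z : ℂ) (n : ℕ) : gs z n = ∑ t ∈ Finset.range n, cexp (I * z * t) := rfl

/-- [folklore] At a real momentum `kAl N (ofRealVec pr) m κ = ↑(kfine N pr m κ)` (both use the representative `repZ m κ = val (m κ)`). -/
theorem kAl_ofRealVec (N : ℕ) [NeZero N] (pr : Fin D → ℝ) (m : TorusSite D N) (κ : Fin D) :
    kAl N (ofRealVec pr) m κ = ((kfine N pr m κ : ℝ) : ℂ) := by
  rw [kAl_apply]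
  unfold kfine ofRealVec
  rw [show repZ m κ = ((m κ).val : ℤ) from rfl]
  push_cast
  ring

/-- [folklore] `‖s_{M,κ}(m)‖ = ‖G(k_{m,κ}, M)‖` with the real fine momentum `k = kfine`. -/
theorem norm_sMAl_ofRealVec (N M : ℕ) [NeZero N] (pr : Fin D → ℝ) (m : TorusSite D N) (κ : Fin D) :
    ‖sMAl N M (ofRealVec pr) m κ‖ = ‖∑ t ∈ Finset.range M, cexp (I * (kfine N pr m κ : ℝ) * t)‖ := by
  unfold sMAl
  rw [kAl_ofRealVec, gs_eq]

/-- [folklore] The reading phase is unimodular at real momenta. -/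
theorem norm_readPhase_ofRealVec (N M : ℕ) [NeZero N] (pr : Fin D → ℝ) (m : TorusSite D N) (ρ : Fin D → ℤ) :
    ‖cexp (I * ∑ i, kAl N (ofRealVec pr) m i * ((M : ℂ) * (ρ i : ℂ)))‖ = 1 := by
  have h : ∑ i, kAl N (ofRealVec pr) m i * ((M : ℂ) * (ρ i : ℂ)) = ((∑ i, kfine N pr m i * ((M : ℝ) * (ρ i : ℝ)) : ℝ) : ℂ) := by
    push_cast
    exact Finset.sum_congr rfl fun i _ => by rw [kAl_ofRealVec]
  rw [h, Complex.norm_exp_I_mul_ofReal]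

/-- [folklore] **MODULUS OF THE READING WEIGHT** at real momenta: `‖readW N M p m κ ρ‖ = (Π_i ‖s_{M,i}(m)‖)·‖s_{M,κ}(m)‖ / M^{D+1}`. -/
theorem norm_readW_ofRealVec (N M : ℕ) [NeZero N] (pr : Fin D → ℝ) (m : TorusSite D N) (κ : Fin D) (ρ : Fin D → ℤ) :
    ‖readW N M (ofRealVec pr) m κ ρ‖
      = (∏ i, ‖sMAl N M (ofRealVec pr) m i‖) * ‖sMAl N M (ofRealVec pr) m κ‖ / (M : ℝ) ^ (D + 1) := by
  unfold readW SMAl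
  rw [norm_div, norm_mul, norm_mul, norm_readPhase_ofRealVec, one_mul, norm_prod, norm_pow, Complex.norm_natCast]

/-- [folklore] **MODULUS OF THE SOURCE WEIGHT** at real momenta: `‖srcW‖ = ‖readW‖ / N^D` (T00's `srcW_eq_conj`). -/
theorem norm_srcW_ofRealVec (N M : ℕ) [NeZero N] (pr : Fin D → ℝ) (m : TorusSite D N) (κ : Fin D) (ρ : Fin D → ℤ) :
    ‖srcW N M (ofRealVec pr) m κ ρ‖ = ‖readW N M (ofRealVec pr) m κ ρ‖ / (N : ℝ) ^ D := by
  rw [srcW_eq_conj (conj_ofRealVec pr), norm_div, Complex.norm_conj, norm_pow, Complex.norm_natCast]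

/-! ## §2  The per-coordinate majorant and the RELATIVE reading-modulus rate -/
/-- The per-coordinate MAJORANT of the normalised reading factor and of its limit at ratio `ρ = M/N`: `rdMaj ρ q = min(1, π/(ρ|q|))`. -/
def rdMaj (ρ q : ℝ) : ℝ := min 1 (π / (ρ * |q|))

/-- [folklore] `0 ≤ rdMaj ρ q` for `ρ ≥ 0`. -/
theorem rdMaj_nonneg {ρ : ℝ} (hρ : 0 ≤ ρ) (q : ℝ) : 0 ≤ rdMaj ρ q := by
  unfold rdMaj
  exact le_min zero_le_one (by positivity)

/-- [folklore] `rdMaj ρ q ≤ 1`. -/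
theorem rdMaj_le_one (ρ q : ℝ) : rdMaj ρ q ≤ 1 := min_le_left _ _

/-- [folklore] `rdMaj ρ q ≤ π/(ρ|q|)`. -/
theorem rdMaj_le_div (ρ q : ℝ) : rdMaj ρ q ≤ π / (ρ * |q|) := min_le_right _ _

/-- [folklore] `sincAt ρ q ≤ rdMaj ρ q` for `ρ > 0` (`sincAt ≤ 1` and `sincAt ≤ 2/(ρ|q|) ≤ π/(ρ|q|)`). -/
theorem sincAt_le_rdMaj {ρ : ℝ} (hρ : 0 < ρ) (q : ℝ) : sincAt ρ q ≤ rdMaj ρ q := by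
  unfold rdMaj
  refine le_min (sincAt_le_one ρ q) ?_
  rcases eq_or_ne q 0 with rfl | hq
  · simp [sincAt]
  · have hqa : 0 < |q| := abs_pos.2 hq
    unfold sincAt
    rw [div_le_div_iff_of_pos_right (by positivity)]
    have := Real.abs_sin_le_one (ρ * q / 2)
    linarith [Real.pi_gt_three]

/-- [folklore] `‖G(q/N, M)‖/M ≤ rdMaj (M/N) q` for `0 < |q| ≤ πN` (`≤ 1` always; `≤ 1/(M|sin(q/2N)|) ≤ πN/(M|q|)` by Jordan). -/
theorem norm_gs_div_le_rdMaj {M N : ℕ} (hM : 0 < M) (hN : 0 < N) {q : ℝ} (hq0 : q ≠ 0) (hq : |q| ≤ π * N) :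
    ‖∑ t ∈ Finset.range M, cexp (I * (q / N : ℝ) * t)‖ / M ≤ rdMaj ((M : ℝ) / N) q := by
  have hπ := Real.pi_pos
  have hMr : (0 : ℝ) < M := by exact_mod_cast hM
  have hNr : (0 : ℝ) < N := by exact_mod_cast hN
  have hqa : 0 < |q| := abs_pos.2 hq0
  unfold rdMaj
  refine le_min ?_ ?_
  · rw [div_le_one hMr]
    exact norm_geomExp_le _ _
  · -- Jordan: |sin(q/(2N))| ≥ |q|/(πN)
    have ht : |q / N / 2| ≤ π / 2 := by
      rw [abs_div, abs_div, abs_of_pos hNr, abs_two, div_div, div_le_iff₀ (by positivity)]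
      nlinarith
    have hsin : 2 / π * |q / N / 2| ≤ |Real.sin (q / N / 2)| := by
      -- |sin t| = sin |t| on |t| ≤ π/2 and Jordan
      have key : ∀ t : ℝ, |t| ≤ π / 2 → 2 / π * |t| ≤ |Real.sin t| := by
        intro t ht'
        rcases le_total 0 t with h | h
        · rw [abs_of_nonneg h] at ht' ⊢
          exact (Real.mul_le_sin h ht').trans (le_abs_self _)
        · rw [abs_of_nonpos h] at ht' ⊢
          have := Real.mul_le_sin (by linarith : 0 ≤ -t) ht'
          rw [Real.sin_neg] at this
          exact this.trans (neg_le_abs _)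
      exact key _ ht
    have hsin_pos : 0 < |Real.sin (q / N / 2)| := lt_of_lt_of_le (by positivity) hsin
    have hG := norm_geomExp_le_inv_sin (q / N) M (abs_pos.1 hsin_pos)
    -- ‖G‖/M ≤ 1/(M|sin|) ≤ πN/(M|q|) = π/((M/N)|q|)
    have h1 : ‖∑ t ∈ Finset.range M, cexp (I * (q / N : ℝ) * t)‖ / M ≤ 1 / |Real.sin (q / N / 2)| / M :=
      div_le_div_of_nonneg_right hG hMr.le
    refine h1.trans ?_
    rw [abs_div, abs_div, abs_of_pos hNr, abs_two] at hsin
    rw [div_div, div_le_div_iff₀ (by positivity) (by positivity)]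
    have e : 2 / π * (|q| / N / 2) = |q| / (π * N) := by field_simp
    rw [e] at hsin
    calc 1 * ((M : ℝ) / N * |q|) = (|q| / (π * N)) * (π * M) := by field_simp
      _ ≤ |Real.sin (q / N / 2)| * (π * M) := mul_le_mul_of_nonneg_right hsin (by positivity)
      _ = π * (|Real.sin (q / N / 2)| * M) := by ring

/-- [folklore] **RELATIVE READING-MODULUS RATE**: for `0 < |q| ≤ πN`, `| ‖G(q/N, M)‖/M − sincAt (M/N) q | ≤ (π/48)·(q²/N²)·sincAt (M/N) q`
(with `t = q/(2N)`: `r − L = L·(|t|/|sin t| − 1)` and `||t|/|sin t| − 1| ≤ (π/12)t²`; the `|q|⁻¹` decay of the weight is preserved). -/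
theorem norm_gs_div_sub_sincAt_le_rel {M N : ℕ} (hM : 0 < M) (hN : 0 < N) {q : ℝ} (hq0 : q ≠ 0) (hq : |q| ≤ π * N) :
    abs (‖∑ t ∈ Finset.range M, cexp (I * (q / N : ℝ) * t)‖ / M - sincAt ((M : ℝ) / N) q)
      ≤ π / 48 * (q ^ 2 / N ^ 2) * sincAt ((M : ℝ) / N) q := by
  have hπ := Real.pi_pos
  have hMr : (0 : ℝ) < M := by exact_mod_cast hM
  have hNr : (0 : ℝ) < N := by exact_mod_cast hN
  have hqa : 0 < |q| := abs_pos.2 hq0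
  have ht_abs : |q / N / 2| = |q| / N / 2 := by rw [abs_div, abs_div, abs_of_pos hNr, abs_two]
  have ht0 : q / N / 2 ≠ 0 := by positivity
  have ht : |q / N / 2| ≤ π / 2 := by
    rw [ht_abs, div_div, div_le_iff₀ (by positivity)]
    nlinarith
  have hsin_ne : Real.sin (q / N / 2) ≠ 0 := by
    intro h0
    have h1 : -π < q / N / 2 := by have := (abs_le.1 ht).1; linarith
    have h2 : q / N / 2 < π := by have := (abs_le.1 ht).2; linarith
    exact ht0 ((Real.sin_eq_zero_iff_of_lt_of_lt h1 h2).1 h0)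
  have hG := norm_geomExp_eq_div (q / N) M hsin_ne
  set S := |Real.sin (M * (q / N) / 2)| with hS
  have hlim : sincAt ((M : ℝ) / N) q = S / (M * |q / N / 2|) := by
    unfold sincAt
    rw [hS, ht_abs, show (M : ℝ) / N * q / 2 = M * (q / N) / 2 by ring]
    field_simp
  have hkey := abs_inv_abs_sin_sub_inv_abs_le ht0 ht
  have hsabs : 0 < |Real.sin (q / N / 2)| := abs_pos.2 hsin_ne
  have htpos : 0 < |q / N / 2| := abs_pos.2 ht0
  have hL0 : 0 ≤ sincAt ((M : ℝ) / N) q := sincAt_nonneg (by positivity) q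
  -- r − L = L · (|t|·(1/|sin t| − 1/|t|))
  have hdiff : ‖∑ t ∈ Finset.range M, cexp (I * (q / N : ℝ) * t)‖ / M - sincAt ((M : ℝ) / N) q
      = sincAt ((M : ℝ) / N) q * (|q / N / 2| * (1 / |Real.sin (q / N / 2)| - 1 / |q / N / 2|)) := by
    rw [hG, hlim, hS]
    field_simp
  rw [hdiff, abs_mul, abs_of_nonneg hL0, abs_mul, abs_abs]
  calc sincAt ((M : ℝ) / N) q * (|q / N / 2| * abs (1 / |Real.sin (q / N / 2)| - 1 / |q / N / 2|))
      ≤ sincAt ((M : ℝ) / N) q * (|q / N / 2| * (π / 12 * |q / N / 2|)) :=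
        mul_le_mul_of_nonneg_left (mul_le_mul_of_nonneg_left hkey (abs_nonneg _)) hL0
    _ = π / 48 * (q ^ 2 / N ^ 2) * sincAt ((M : ℝ) / N) q := by
        rw [ht_abs]
        field_simp
        rw [sq_abs]
        ring

/-- [folklore] **TWO-LEVEL RELATIVE RATE**: same ratio `M/N = M′/N′`, `0 < |q| ≤ π·min(N, N′)` ⇒ `|r_N − r_{N′}| ≤ (π/48)q²(N⁻²+N′⁻²)·rdMaj`. -/
theorem norm_gs_div_two_level_le {M N M' N' : ℕ} (hM : 0 < M) (hN : 0 < N) (hM' : 0 < M') (hN' : 0 < N')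
    (hratio : (M : ℝ) * N' = M' * N) {q : ℝ} (hq0 : q ≠ 0) (hq : |q| ≤ π * N) (hq' : |q| ≤ π * N') :
    abs (‖∑ t ∈ Finset.range M, cexp (I * (q / N : ℝ) * t)‖ / M - ‖∑ t ∈ Finset.range M', cexp (I * (q / N' : ℝ) * t)‖ / M')
      ≤ π / 48 * q ^ 2 * (1 / (N : ℝ) ^ 2 + 1 / (N' : ℝ) ^ 2) * rdMaj ((M : ℝ) / N) q := by
  have h1 := norm_gs_div_sub_sincAt_le_rel hM hN hq0 hq
  have h2 := norm_gs_div_sub_sincAt_le_rel hM' hN' hq0 hq'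
  have hNr : (N : ℝ) ≠ 0 := by exact_mod_cast hN.ne'
  have hN'r : (N' : ℝ) ≠ 0 := by exact_mod_cast hN'.ne'
  have hρ : (M : ℝ) / N = (M' : ℝ) / N' := by rw [div_eq_div_iff hNr hN'r]; linarith
  rw [← hρ] at h2
  have hMr : (0 : ℝ) < M := by exact_mod_cast hM
  have hNpos : (0 : ℝ) < N := by exact_mod_cast hN
  have hρpos : (0 : ℝ) < M / N := by positivity
  have hLM : sincAt ((M : ℝ) / N) q ≤ rdMaj ((M : ℝ) / N) q := sincAt_le_rdMaj hρpos q
  have hL0 : 0 ≤ sincAt ((M : ℝ) / N) q := sincAt_nonneg hρpos.le q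
  set a := ‖∑ t ∈ Finset.range M, cexp (I * (q / N : ℝ) * t)‖ / (M : ℝ) with ha
  set c := ‖∑ t ∈ Finset.range M', cexp (I * (q / N' : ℝ) * t)‖ / (M' : ℝ) with hc
  set L := sincAt ((M : ℝ) / N) q with hL
  calc abs (a - c) ≤ abs (a - L) + abs (L - c) := abs_sub_le a L c
    _ ≤ π / 48 * (q ^ 2 / N ^ 2) * L + π / 48 * (q ^ 2 / N' ^ 2) * L := by
        refine add_le_add h1 ?_
        rw [abs_sub_comm]
        exact h2
    _ = π / 48 * q ^ 2 * (1 / (N : ℝ) ^ 2 + 1 / (N' : ℝ) ^ 2) * L := by ring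
    _ ≤ _ := mul_le_mul_of_nonneg_left hLM (by positivity)

/-- [folklore] From a relative rate to the SQUARED weights: if `|a|, |b| ≤ c`, `0 ≤ c` and `|a − b| ≤ e·c` then `|a² − b²| ≤ 2e·c²`. -/
theorem abs_sq_sub_sq_le_of_rel {a b c e : ℝ} (ha : |a| ≤ c) (hb : |b| ≤ c) (hc : 0 ≤ c) (h : |a - b| ≤ e * c) :
    |a ^ 2 - b ^ 2| ≤ 2 * e * c ^ 2 := by
  rw [sq_sub_sq, abs_mul]
  calc |a + b| * |a - b| ≤ (c + c) * (e * c) :=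
        mul_le_mul ((abs_add_le a b).trans (add_le_add ha hb)) h (abs_nonneg _) (by positivity)
    _ = 2 * e * c ^ 2 := by ring

/-- [folklore] **SQUARED READING WEIGHT, UNIFORM TWO-LEVEL RATE**: same ratio, `0 < |q| ≤ π·min(N,N′)` ⇒
`| r_N² − r_{N′}² | ≤ (π/24)·q²·(1/N² + 1/N′²)·rdMaj (M/N) q ²`, and since `rdMaj ρ q · |q| ≤ π/ρ` this is `≤ (π³/24)·ρ⁻²·(1/N² + 1/N′²)`
UNIFORMLY in the label `q` (`ρ⁻² = Lc²`): the `q²` of the rate is eaten by the decay of the weight. -/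
theorem abs_sq_sub_sq_le_uniform {M N M' N' : ℕ} (hM : 0 < M) (hN : 0 < N) (hM' : 0 < M') (hN' : 0 < N')
    (hratio : (M : ℝ) * N' = M' * N) {q : ℝ} (hq0 : q ≠ 0) (hq : |q| ≤ π * N) (hq' : |q| ≤ π * N') :
    |(‖∑ t ∈ Finset.range M, cexp (I * (q / N : ℝ) * t)‖ / M) ^ 2 - (‖∑ t ∈ Finset.range M', cexp (I * (q / N' : ℝ) * t)‖ / M') ^ 2|
      ≤ π / 24 * q ^ 2 * (1 / (N : ℝ) ^ 2 + 1 / (N' : ℝ) ^ 2) * rdMaj ((M : ℝ) / N) q ^ 2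
    ∧ π / 24 * q ^ 2 * (1 / (N : ℝ) ^ 2 + 1 / (N' : ℝ) ^ 2) * rdMaj ((M : ℝ) / N) q ^ 2
      ≤ π ^ 3 / 24 * (((M : ℝ) / N) ^ 2)⁻¹ * (1 / (N : ℝ) ^ 2 + 1 / (N' : ℝ) ^ 2) := by
  have hπ := Real.pi_pos
  have hMr : (0 : ℝ) < M := by exact_mod_cast hM
  have hNr : (0 : ℝ) < N := by exact_mod_cast hN
  have hNr' : (N' : ℝ) ≠ 0 := by exact_mod_cast hN'.ne'
  have hρ : (M : ℝ) / N = (M' : ℝ) / N' := by rw [div_eq_div_iff hNr.ne' hNr']; linarith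
  have hρpos : (0 : ℝ) < M / N := by positivity
  have hc0 : 0 ≤ rdMaj ((M : ℝ) / N) q := rdMaj_nonneg hρpos.le q
  have ha : |‖∑ t ∈ Finset.range M, cexp (I * (q / N : ℝ) * t)‖ / (M : ℝ)| ≤ rdMaj ((M : ℝ) / N) q := by
    rw [abs_of_nonneg (by positivity)]; exact norm_gs_div_le_rdMaj hM hN hq0 hq
  have hb : |‖∑ t ∈ Finset.range M', cexp (I * (q / N' : ℝ) * t)‖ / (M' : ℝ)| ≤ rdMaj ((M : ℝ) / N) q := by
    rw [abs_of_nonneg (by positivity), hρ]; exact norm_gs_div_le_rdMaj hM' hN' hq0 hq'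
  have hrate := norm_gs_div_two_level_le hM hN hM' hN' hratio hq0 hq hq'
  constructor
  · have h := abs_sq_sub_sq_le_of_rel ha hb hc0 hrate
    calc _ ≤ 2 * (π / 48 * q ^ 2 * (1 / (N : ℝ) ^ 2 + 1 / (N' : ℝ) ^ 2)) * rdMaj ((M : ℝ) / N) q ^ 2 := h
      _ = _ := by ring
  · -- rdMaj · |q| ≤ π/ρ
    have hqa : 0 < |q| := abs_pos.2 hq0
    have hprod : rdMaj ((M : ℝ) / N) q * |q| ≤ π / ((M : ℝ) / N) := by
      have := rdMaj_le_div ((M : ℝ) / N) q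
      calc rdMaj ((M : ℝ) / N) q * |q| ≤ π / ((M : ℝ) / N * |q|) * |q| := mul_le_mul_of_nonneg_right this hqa.le
        _ = π / ((M : ℝ) / N) := by field_simp
    have hsq : rdMaj ((M : ℝ) / N) q ^ 2 * q ^ 2 ≤ π ^ 2 / ((M : ℝ) / N) ^ 2 := by
      rw [← sq_abs q, ← mul_pow, ← div_pow]
      exact pow_le_pow_left₀ (by positivity) hprod 2
    have hfac : 0 ≤ π / 24 * (1 / (N : ℝ) ^ 2 + 1 / (N' : ℝ) ^ 2) := by positivity
    calc π / 24 * q ^ 2 * (1 / (N : ℝ) ^ 2 + 1 / (N' : ℝ) ^ 2) * rdMaj ((M : ℝ) / N) q ^ 2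
        = π / 24 * (1 / (N : ℝ) ^ 2 + 1 / (N' : ℝ) ^ 2) * (rdMaj ((M : ℝ) / N) q ^ 2 * q ^ 2) := by ring
      _ ≤ π / 24 * (1 / (N : ℝ) ^ 2 + 1 / (N' : ℝ) ^ 2) * (π ^ 2 / ((M : ℝ) / N) ^ 2) :=
          mul_le_mul_of_nonneg_left hsq hfac
      _ = _ := by rw [inv_eq_one_div]; ring

/-! ## §3  Product telescoping over the coordinates (item (iii)) -/
/-- [folklore] PRODUCT TELESCOPING WITH MAJORANTS: if `|a_j| ≤ c_j` and `|b_j| ≤ c_j` on `s` then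
`|Π_{s} a − Π_{s} b| ≤ Σ_{i∈s} |a_i − b_i| · Π_{j ∈ s∖{i}} c_j`. -/
theorem abs_prod_sub_prod_le_sum {ι : Type*} [DecidableEq ι] (s : Finset ι) (a b c : ι → ℝ)
    (ha : ∀ j ∈ s, |a j| ≤ c j) (hb : ∀ j ∈ s, |b j| ≤ c j) :
    |∏ j ∈ s, a j - ∏ j ∈ s, b j| ≤ ∑ i ∈ s, |a i - b i| * ∏ j ∈ s.erase i, c j := by
  induction s using Finset.induction_on with
  | empty => simp
  | @insert k s hk ih =>
    have ha' : ∀ j ∈ s, |a j| ≤ c j := fun j hj => ha j (Finset.mem_insert_of_mem hj)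
    have hb' : ∀ j ∈ s, |b j| ≤ c j := fun j hj => hb j (Finset.mem_insert_of_mem hj)
    have hc' : ∀ j ∈ s, 0 ≤ c j := fun j hj => (abs_nonneg _).trans (ha' j hj)
    have hA : |∏ j ∈ s, a j| ≤ ∏ j ∈ s, c j := by
      rw [Finset.abs_prod]
      exact Finset.prod_le_prod (fun j _ => abs_nonneg _) ha'
    have hbk : |b k| ≤ c k := hb k (Finset.mem_insert_self k s)
    rw [Finset.prod_insert hk, Finset.prod_insert hk, Finset.sum_insert hk, Finset.erase_insert hk]
    have hsum : ∑ i ∈ s, |a i - b i| * ∏ j ∈ (insert k s).erase i, c j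
        = c k * ∑ i ∈ s, |a i - b i| * ∏ j ∈ s.erase i, c j := by
      rw [Finset.mul_sum]
      refine Finset.sum_congr rfl fun i hi => ?_
      have hki : k ≠ i := fun h => hk (h ▸ hi)
      rw [Finset.erase_insert_of_ne hki, Finset.prod_insert (fun h => hk (Finset.mem_of_mem_erase h))]
      ring
    rw [hsum]
    calc |a k * ∏ j ∈ s, a j - b k * ∏ j ∈ s, b j|
        ≤ |a k - b k| * |∏ j ∈ s, a j| + |b k| * |∏ j ∈ s, a j - ∏ j ∈ s, b j| := by
          have e : a k * ∏ j ∈ s, a j - b k * ∏ j ∈ s, b j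
              = (a k - b k) * ∏ j ∈ s, a j + b k * (∏ j ∈ s, a j - ∏ j ∈ s, b j) := by ring
          rw [e]
          exact (abs_add_le _ _).trans (by rw [abs_mul, abs_mul])
      _ ≤ |a k - b k| * ∏ j ∈ s, c j + c k * ∑ i ∈ s, |a i - b i| * ∏ j ∈ s.erase i, c j :=
          add_le_add (mul_le_mul_of_nonneg_left hA (abs_nonneg _))
            (mul_le_mul hbk (ih ha' hb') (abs_nonneg _) ((abs_nonneg _).trans hbk))

/-- [folklore] **`D`-FOLD SQUARED READING WEIGHT, TWO-LEVEL RATE** (item (iii) for the factor `|S_M(m)|²/M^{2D}` in label currency):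
with `r_N(q_i) = ‖G(q_i/N, M)‖/M`, same ratio at both levels and `0 < |q_i| ≤ π·min(N, N′)` for every `i`,
`|Π_i r_N(q_i)² − Π_i r_{N′}(q_i)²| ≤ (π³/24)·ρ⁻²·(1/N² + 1/N′²) · Σ_i Π_{j≠i} rdMaj ρ q_j ²`, `ρ = M/N`. -/
theorem abs_prod_sq_sub_prod_sq_le {M N M' N' : ℕ} (hM : 0 < M) (hN : 0 < N) (hM' : 0 < M') (hN' : 0 < N')
    (hratio : (M : ℝ) * N' = M' * N) {q : Fin D → ℝ} (hq0 : ∀ i, q i ≠ 0) (hq : ∀ i, |q i| ≤ π * N) (hq' : ∀ i, |q i| ≤ π * N') :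
    |∏ i, (‖∑ t ∈ Finset.range M, cexp (I * (q i / N : ℝ) * t)‖ / M) ^ 2
        - ∏ i, (‖∑ t ∈ Finset.range M', cexp (I * (q i / N' : ℝ) * t)‖ / M') ^ 2|
      ≤ π ^ 3 / 24 * (((M : ℝ) / N) ^ 2)⁻¹ * (1 / (N : ℝ) ^ 2 + 1 / (N' : ℝ) ^ 2)
          * ∑ i, ∏ j ∈ Finset.univ.erase i, rdMaj ((M : ℝ) / N) (q j) ^ 2 := by
  classical
  have hMr : (0 : ℝ) < M := by exact_mod_cast hM
  have hNr : (0 : ℝ) < N := by exact_mod_cast hN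
  have hNr' : (N' : ℝ) ≠ 0 := by exact_mod_cast hN'.ne'
  have hρ : (M : ℝ) / N = (M' : ℝ) / N' := by rw [div_eq_div_iff hNr.ne' hNr']; linarith
  have hρpos : (0 : ℝ) < M / N := by positivity
  set a : Fin D → ℝ := fun i => (‖∑ t ∈ Finset.range M, cexp (I * (q i / N : ℝ) * t)‖ / M) ^ 2 with ha
  set b : Fin D → ℝ := fun i => (‖∑ t ∈ Finset.range M', cexp (I * (q i / N' : ℝ) * t)‖ / M') ^ 2 with hb
  set c : Fin D → ℝ := fun i => rdMaj ((M : ℝ) / N) (q i) ^ 2 with hc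
  set E : ℝ := π ^ 3 / 24 * (((M : ℝ) / N) ^ 2)⁻¹ * (1 / (N : ℝ) ^ 2 + 1 / (N' : ℝ) ^ 2) with hE
  have hac : ∀ j ∈ (Finset.univ : Finset (Fin D)), |a j| ≤ c j := fun j _ => by
    rw [ha, hc, abs_of_nonneg (by positivity)]
    exact pow_le_pow_left₀ (by positivity) (norm_gs_div_le_rdMaj hM hN (hq0 j) (hq j)) 2
  have hbc : ∀ j ∈ (Finset.univ : Finset (Fin D)), |b j| ≤ c j := fun j _ => by
    rw [hb, hc, abs_of_nonneg (by positivity), hρ]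
    exact pow_le_pow_left₀ (by positivity) (norm_gs_div_le_rdMaj hM' hN' (hq0 j) (hq' j)) 2
  have hdiff : ∀ i, |a i - b i| ≤ E := fun i => by
    have h := abs_sq_sub_sq_le_uniform hM hN hM' hN' hratio (hq0 i) (hq i) (hq' i)
    exact h.1.trans h.2
  have htel := abs_prod_sub_prod_le_sum Finset.univ a b c hac hbc
  refine htel.trans ?_
  rw [Finset.mul_sum]
  refine Finset.sum_le_sum fun i _ => ?_
  exact mul_le_mul_of_nonneg_right (hdiff i) (Finset.prod_nonneg fun j _ => by rw [hc]; positivity)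

/-! ## §4  The alias TAIL of the squared reading weights (item (iv)), via `GAN24/AliasTail` -/
/-- [folklore] In alias-offset currency `q = p + 2πn` (`|p| ≤ π`, `n ∈ ℤ`) the squared majorant is a King alias majorant:
`rdMaj ρ q ² ≤ max(1, π/ρ²) · aliasMaj 2 p n` (`n = 0`: `≤ 1`; `n ≠ 0`: `≤ π²/(ρ²q²) = (π/ρ²)·π|q|⁻²`). -/
theorem rdMaj_sq_le_aliasMaj {ρ : ℝ} (hρ : 0 < ρ) {p : ℝ} (hp : |p| ≤ π) (n : ℤ) :
    rdMaj ρ (p + 2 * π * n) ^ 2 ≤ max 1 (π / ρ ^ 2) * aliasMaj 2 p n := by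
  have hπ := Real.pi_pos
  have h0 : 0 ≤ rdMaj ρ (p + 2 * π * n) := rdMaj_nonneg hρ.le _
  have h1 : rdMaj ρ (p + 2 * π * n) ≤ 1 := rdMaj_le_one _ _
  unfold aliasMaj
  split_ifs with hn
  · rw [mul_one]
    calc rdMaj ρ (p + 2 * π * n) ^ 2 ≤ 1 := by nlinarith
      _ ≤ max 1 (π / ρ ^ 2) := le_max_left _ _
  · have hq : π ≤ |p + 2 * π * n| := Literature.MathematicalPhysics.QuantumFieldTheory.King1986.pi_le_abs_add hp hn
    have hqpos : 0 < |p + 2 * π * n| := lt_of_lt_of_le hπ hq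
    have hle : rdMaj ρ (p + 2 * π * n) ≤ π / (ρ * |p + 2 * π * n|) := rdMaj_le_div _ _
    have hrpow : |p + 2 * π * (n : ℝ)| ^ (-(2 : ℝ)) = (|p + 2 * π * n| ^ 2)⁻¹ := by
      rw [Real.rpow_neg (abs_nonneg _), Real.rpow_two]
    rw [hrpow]
    calc rdMaj ρ (p + 2 * π * n) ^ 2 ≤ (π / (ρ * |p + 2 * π * n|)) ^ 2 := pow_le_pow_left₀ h0 hle 2
      _ = π / ρ ^ 2 * (π * (|p + 2 * π * ↑n| ^ 2)⁻¹) := by field_simp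
      _ ≤ max 1 (π / ρ ^ 2) * (π * (|p + 2 * π * ↑n| ^ 2)⁻¹) :=
          mul_le_mul_of_nonneg_right (le_max_right _ _) (by positivity)

/-- [folklore] **TAIL OF THE SQUARED READING WEIGHTS** (item (iv)): for `p ∈ [−π, π]^D`, `ρ > 0`, `R ≥ 1` and any finite family `Λ` of
alias offsets each having a coordinate with `|n_ν| > R` (the labels of level `N·Lc` that are absent at level `N`),
`Σ_{n ∈ Λ} Π_μ rdMaj ρ (p_μ + 2πn_μ)² ≤ max(1, π/ρ²)^D · D·(2/π)·(1 + 4/π)^{D−1} / R` — E3 `AliasTail` at `s = 2` BY NAME. -/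
theorem sum_prod_rdMaj_sq_tail_le {ρ : ℝ} (hρ : 0 < ρ) {p : Fin D → ℝ} (hp : ∀ μ, |p μ| ≤ π) {R : ℕ} (hR : 1 ≤ R)
    {Λ : Finset (Fin D → ℤ)} (hfar : ∀ n ∈ Λ, ∃ ν, (R : ℤ) < |n ν|) :
    ∑ n ∈ Λ, ∏ μ, rdMaj ρ (p μ + 2 * π * n μ) ^ 2
      ≤ (max 1 (π / ρ ^ 2)) ^ D * (D * (2 / π) * (1 + 4 / π) ^ (D - 1) / R) := by
  classical
  have hterm : ∀ n ∈ Λ, ∏ μ, rdMaj ρ (p μ + 2 * π * n μ) ^ 2 ≤ (max 1 (π / ρ ^ 2)) ^ D * ∏ μ, aliasMaj 2 (p μ) (n μ) := by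
    intro n _
    rw [show (max 1 (π / ρ ^ 2)) ^ D = ∏ _μ : Fin D, max 1 (π / ρ ^ 2) by
          rw [Finset.prod_const, Finset.card_univ, Fintype.card_fin], ← Finset.prod_mul_distrib]
    exact Finset.prod_le_prod (fun μ _ => by positivity) fun μ _ => rdMaj_sq_le_aliasMaj hρ (hp μ) (n μ)
  obtain ⟨K, hKsub⟩ := AliasTail.exists_subset_aliasBox Λ
  have hsub : Λ ⊆ (aliasBox D K).filter (fun j => ∃ ν, (R : ℤ) < |j ν|) := fun n hn =>
    Finset.mem_filter.2 ⟨hKsub hn, hfar n hn⟩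
  have htail := AliasTail.sum_prod_aliasMaj_two_tail_le (D := D) hp hR K
  calc ∑ n ∈ Λ, ∏ μ, rdMaj ρ (p μ + 2 * π * n μ) ^ 2
      ≤ ∑ n ∈ Λ, (max 1 (π / ρ ^ 2)) ^ D * ∏ μ, aliasMaj 2 (p μ) (n μ) := Finset.sum_le_sum hterm
    _ = (max 1 (π / ρ ^ 2)) ^ D * ∑ n ∈ Λ, ∏ μ, aliasMaj 2 (p μ) (n μ) := by rw [Finset.mul_sum]
    _ ≤ (max 1 (π / ρ ^ 2)) ^ D * ∑ n ∈ (aliasBox D K).filter (fun j => ∃ ν, (R : ℤ) < |j ν|), ∏ μ, aliasMaj 2 (p μ) (n μ) := by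
        refine mul_le_mul_of_nonneg_left ?_ (by positivity)
        exact Finset.sum_le_sum_of_subset_of_nonneg hsub fun n _ _ => Finset.prod_nonneg fun μ _ => aliasMaj_nonneg _ _ _
    _ ≤ (max 1 (π / ρ ^ 2)) ^ D * (D * (2 / π) * (1 + 4 / π) ^ (D - 1) / R) :=
        mul_le_mul_of_nonneg_left htail (by positivity)

end Summit.QuantumFields.BalabanUV.Beta.GAN24.ReadingWeightRatesSum

end
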